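import Literature.AnabelianGeometry.EtaleTheta.Discharge.Sec5Prop51Thm44Pin
import Literature.AnabelianGeometry.EtaleTheta.TemperedFrobenioidRebase

/-!
# [EtTh] Prop. 5.1 / Thm. 4.4 at the RE-BASED Example 3.9 (iv) Frobenioid (`α = 𝟙_A`, print's §5 choice):
# `Thm44Hyp` with the base-shape clause DISCHARGED, and Prop. 5.1's last pin

Mochizuki, *The étale theta function and its Frobenioid-theoretic manifestations*, Publ. RIMS **45** (2009), Prop. 5.1 p. 323 (PDF p. 97):
"The Frobenioid `C` is a tempered Frobenioid … In particular, `C` and `Ψ` satisfy all of the hypotheses of Theorem 4.4"; §5 p. 322 (PDF p. 96):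
"Suppose further that the morphism `α : A → B` of Example 3.9, (iv), is the identity morphism … `Φ := Φ^ell_α` on `D := D_α` … determines a
tempered Frobenioid `C` of monoid type `ℤ` over the base category `D`"; Ex. 3.9 (iv) p. 311 (PDF p. 85): "`D_X` … special cases of '`D_α`'";
Thm. 4.4 p. 319 (PDF p. 93): "`D_i := B^temp(X_i^log)[𝒟_i]`".  [cite: MochizukiEtTh2009, Prop 5.1 p.323 (PDF p.97); §5 p.322 (PDF p.96)]

PROOF-ONLY (no definitions).  abc-iut cell, layer L2, seat abc-iut-L2-t9 (gen 4; unit W2-L2-05 lineage): the sequel named by census item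
**B9 (B)** (`HOME/staging/L2/L2-t9/census/VNEXT-Thm44HypBaseShape.md`) and by abc-iut-L2-t4's constructor file `TemperedFrobenioidRebase.lean`
(p445978: `Example39Data.thetaFrobenioidRebase E A h := (E.thetaFrobenioid (𝟙 A) h).rebase`, reference category `D₀ := (D_W)_A = D_{𝟙_A}`,
structure functor `𝟭`, `category_thetaFrobenioidRebase`/`ratFnFunctor_rebase`/… all `rfl`, and `baseShape_thetaFrobenioidRebase`).

WHAT IS PROVED.
* `Example39Data.hypothesesThm44_thetaFrobenioidRebase` — Prop. 5.1's last pin ("`C` and `Ψ` satisfy all of the hypotheses of Theorem 4.4":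
  `Φ` non-dilating and `Ψ` induces `Ψ^bs : D ⥲ D` with `Base ∘ Ψ ≅ Ψ^bs ∘ Base`) for the RE-BASED datum — abc-iut-L2-t9's
  `hypothesesThm44_thetaFrobenioid` (p432820) transported along the `rfl` dictionary of p445978;
* (NOT restated, by design) Prop. 5.1 with all three pins — abc-iut-L2-t9's `applicability_of_example39_allPins` (p432820) — applies VERBATIM to
  §5 data `𝔉` over the re-based datum: its category, divisor monoid, rational functions and `thetaStub` ARE those of `E.thetaFrobenioid (𝟙 A) h`
  (p445978: `category_thetaFrobenioidRebase`, `divisorMonoid_rebase`, `ratFn_rebase`, all `rfl`), so `𝔉 : ThetaFrobenioid (E.thetaFrobenioidRebase A h).category _`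
  IS a `ThetaFrobenioid (E.thetaFrobenioid (𝟙 A) h).category _`; a syntactic re-statement at `E.thetaFrobenioidRebase A h` was tried and dropped —
  its definitional unification (the `thetaVocab` record, `biratData`, `rsParams`) exceeds the default heartbeat budget, and it adds no content;
* **`Example39Data.exists_thm44Hyp_thetaFrobenioidRebase`** — abc-iut-L2-t3's `BiKummerSetting.Thm44Hyp S S` for the §5 bi-Kummer setting
  `S := mkOfModelCanonical X (E.thetaFrobenioidRebase A h) …` over the RE-BASED Example 3.9 (iv) Frobenioid, for every self-equivalence `Ψ`, with
  the base-shape clause "`D = D₀[𝒟]`" **DISCHARGED** (`𝒟 := (A, 𝟙_A)`, abc-iut-L2-t4's `baseShape_thetaFrobenioidRebase`) — the binder `hshape` of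
  abc-iut-L2-t9's `exists_thm44Hyp_thetaFrobenioid` is GONE; residual = {`hopen` "`H_⊙` open", `hchar` "`A_⊚^bs` characteristic"} and the named inputs
  {`h34` (F-0711), `hBmon`, `hW`, `hWf`}.  CONTRAST (kernel, p432820 §5): for the UN-re-based `E.thetaFrobenioid (𝟙 A) h` referenced to `D_W` the
  clause "Full" FAILS whenever `Aut_{D_W}(A) ≠ 1` (`not_full_toDW_id_of_ne`) — print's §5 re-basing to `D₀ := B^temp(A^log)⁰ ≅ (D_W)_A` is what
  makes Thm. 4.4 applicable, and this file is its kernel form.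
(abc-iut-w4-d008's `BiKummerSetting.exists_thm44Hyp_self_of_base_isEquivalence`, p445052, is the same observation for the CONNECTED-temperoid
setting `mkOfConnectedTemperoid` when the structure functor is an equivalence; here the setting is abc-iut-L2-t9's model instance
`mkOfModelCanonical` and the structure functor is `𝟭` on the nose.)

UNIVERSE NOTE (abc-iut-L2-t4's, repeated): `BiKummerSetting X T D VD` pins the reference category to the universe of the base field `K`; the re-based
datum has `D₀ := D_{𝟙_A} : Type (max u v)` for `D_W : Type u` with `v`-small hom-sets, so the Thm. 4.4 record is stated for `K : Type (max u v)` (at the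
§1 Setting everything is in `Type`).  HONEST FRAMING: reductions over abc-iut-L2-t3's DATA structures (`Example39Data`, `TemperedFrobenioid`,
`BiKummerSetting`); nothing asserts that these data exist for an actual curve; the anabelian sentence "`A_⊚^bs` is characteristic" stays the binder
`hchar`; [EtTh] is refereed and nothing here bears on [IUTchIII] Cor. 3.12 — no side is taken; typed ≠ proved — here PROVED modulo the displayed inputs.
-/

namespace Literature.AnabelianGeometry.EtaleTheta

open CategoryTheory Opposite Literature.AlgebraicGeometry.Frobenioids FrobenioidTheta TemperedFrobenioid

universe u v w

namespace Example39Data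

/-! ### 1. Proposition 5.1's pins at the re-based Example 3.9 (iv) Frobenioid -/

section TreeVocab

variable {DW : Type u} [Category.{v} DW] {TW : RealifiedDivisorMonoids (D₀ := DW) treeMonoidVocab.{w}}
  (E : Example39Data treeMonoidVocab.{w} DW TW) (A : DW)
  {IsRational IsStrictlyRational : ((Dα (𝟙 A))ᵒᵖ ⥤ CommMonCat.{w}) → Prop}

/-- **Prop. 5.1's last pin at the RE-BASED datum** — "`C` and `Ψ` satisfy all of the hypotheses of Theorem 4.4": `Φ^ell_{𝟙_A}` non-dilating and
every self-equivalence `Ψ` induces `Ψ^bs : D_{𝟙_A} ⥲ D_{𝟙_A}` with `Base ∘ Ψ ≅ Ψ^bs ∘ Base` — abc-iut-L2-t9's `hypothesesThm44_thetaFrobenioid`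
(p432820; [FrdI] Thm. 3.4 (v) over `D_α` slim of FSMFF-type), the re-based datum having the SAME category, divisor monoid and base functor
to its own base (p445978, `rfl`); GIVEN {`h34` (F-0711), `hBmon`, `hW`, `hWf`}.  [cite: MochizukiEtTh2009, Prop 5.1 p.323 (PDF p.97)] -/
theorem hypothesesThm44_thetaFrobenioidRebase
    (h : E.FrobenioidHyp (𝟙 A) (treeCatVocab (Dα (𝟙 A)) IsRational IsStrictlyRational))
    (h34 : FrdI.Thm34ii.{w, v, max v w, max u v, max (max u v) w})
    (hBmon : IsMonoidOn (E.thetaFrobenioidRebase A h).ratFnFunctor) (hW : IsSlim DW) (hWf : IsOfFSMType DW)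
    (Ψ : (E.thetaFrobenioidRebase A h).category ≌ (E.thetaFrobenioidRebase A h).category) :
    (∀ (Y : (Dα (𝟙 A))ᵒᵖ) (f : Y ⟶ Y), treeMonoidVocab.{w}.IsNonDilating ((E.thetaFrobenioidRebase A h).Φ.carrier Y)
        ((E.thetaFrobenioidRebase A h).Φ.pull f)) ∧
      ∃ Ψbs : Dα (𝟙 A) ≌ Dα (𝟙 A), Nonempty ((E.thetaFrobenioidRebase A h).baseFunctorOfCategory ⋙ Ψbs.functor ≅
        Ψ.functor ⋙ (E.thetaFrobenioidRebase A h).baseFunctorOfCategory) :=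
  E.hypothesesThm44_thetaFrobenioid (𝟙 A) h h34 hBmon hW hWf Ψ

end TreeVocab

/-! ### 2. `Thm44Hyp S S` for the §5 bi-Kummer setting over the re-based datum: NO base-shape binder -/

section Setting

variable {K : Type (max u v)} [Field K] (X : SemiGraphs.TemperedArithmeticGroup.{max u v} K)
  {DW : Type u} [Category.{v} DW] {TW : RealifiedDivisorMonoids (D₀ := DW) treeMonoidVocab.{w}}
  (E : Example39Data treeMonoidVocab.{w} DW TW) (A : DW)
  {IsRational IsStrictlyRational : ((Dα (𝟙 A))ᵒᵖ ⥤ CommMonCat.{w}) → Prop}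

/-- **abc-iut-L2-t3's `Thm44Hyp S S` for the §5 bi-Kummer setting over the RE-BASED Example 3.9 (iv) Frobenioid** (print's §5 choice
`α = 𝟙_A`, reference category `D₀ := (D_W)_A = D_{𝟙_A}`, p.311/p.322; `S := mkOfModelCanonical X (E.thetaFrobenioidRebase A h) …`, "monoid type `ℤ`"
= `hZ`, "`Φ` perfect" = Example 3.9 (iii)/(iv); the Galois objects of `D_{𝟙_A}` with `Π^tp_X ↠ Aut(−)`, the `(N,H)`-saturation predicate and the
object `A_⊚` are parameters), for every self-equivalence `Ψ`: EXISTS with underlying `Ψ` — the `(C, Ψ)`-clauses DISCHARGED as in p432820 AND the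
base-shape clause "`D_i := B^temp(X_i^log)[𝒟_i]`" (`Full ∧ Faithful ∧ essImage = D₀[𝒟]`) **DISCHARGED** with `𝒟 := (A, 𝟙_A)` (abc-iut-L2-t4's
`baseShape_thetaFrobenioidRebase`, p445978); residual = {`hopen`, `hchar`} and {`h34`, `hBmon`, `hW`, `hWf`}.  (Un-re-based contrast:
`not_full_toDW_id_of_ne`, p432820.)  [cite: MochizukiEtTh2009, Prop 5.1 p.323 (PDF p.97); Thm 4.4 p.319 (PDF p.93); §5 p.322 (PDF p.96)] -/
theorem exists_thm44Hyp_thetaFrobenioidRebase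
    (h : E.FrobenioidHyp (𝟙 A) (treeCatVocab (Dα (𝟙 A)) IsRational IsStrictlyRational))
    (hZ : TW.Λ = MonoidType.Z) (IG : Dα (𝟙 A) → Prop) (gS : ∀ Y : Dα (𝟙 A), IG Y → (X.Pi →* Aut Y))
    (gSs : ∀ (Y : Dα (𝟙 A)) (hY : IG Y), Function.Surjective (gS Y hY))
    (NH : Subgroup (Field.absoluteGaloisGroup K) → (E.thetaFrobenioidRebase A h).category → ℕ+ → Prop)
    (A₀ : (E.thetaFrobenioidRebase A h).category)
    (hA₀ : PreFrobenioid.IsFrobeniusTrivial (E.thetaFrobenioidRebase A h).toElem A₀) (hA₀' : IG A₀.base)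
    (h34 : FrdI.Thm34ii.{w, v, max v w, max u v, max (max u v) w})
    (hBmon : IsMonoidOn (E.thetaFrobenioidRebase A h).ratFnFunctor) (hW : IsSlim DW) (hWf : IsOfFSMType DW)
    (hopen : IsOpen ((BiKummerSetting.mkOfModelCanonical X (E.thetaFrobenioidRebase A h) hZ (E.isPerfect_Φα (𝟙 A)) IG gS
      gSs NH A₀ hA₀ hA₀').Hodot : Set X.Pi))
    (hchar : ∀ Θ : Dα (𝟙 A) ≌ Dα (𝟙 A), IsIsomorph (Θ.functor.obj A₀.base) A₀.base)
    (Ψ : (E.thetaFrobenioidRebase A h).category ≌ (E.thetaFrobenioidRebase A h).category) :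
    ∃ hh : BiKummerSetting.Thm44Hyp
      (BiKummerSetting.mkOfModelCanonical X (E.thetaFrobenioidRebase A h) hZ (E.isPerfect_Φα (𝟙 A)) IG gS gSs NH A₀ hA₀ hA₀')
      (BiKummerSetting.mkOfModelCanonical X (E.thetaFrobenioidRebase A h) hZ (E.isPerfect_Φα (𝟙 A)) IG gS gSs NH A₀ hA₀ hA₀'),
      hh.Ψ = Ψ :=
  BiKummerSetting.exists_thm44Hyp_mkOfModelCanonical_treeCatVocab X (E.thetaFrobenioidRebase A h) hZ
    (E.isPerfect_Φα (𝟙 A)) IG gS gSs NH A₀ hA₀ hA₀' h34 hBmon (isOfFSMFFType_Dα (𝟙 A) hWf)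
    (fun Y f => E.isNonDilating_Φα (𝟙 A) Y f) (isSlim_Dα (𝟙 A) hW) (E.baseShape_thetaFrobenioidRebase A h) hopen hchar Ψ

/-- The same with the underlying `Thm44Hyp` delivered together with the pinned `(C, Ψ)`-clauses it yields back (abc-iut-L2-t9's dictionary
`hypothesesThm44_of_thm44Hyp`, p432820): nothing of the typed hypothesis on the pair `(C, Ψ)` is lost by the pin at the re-based datum either.
[cite: MochizukiEtTh2009, Thm 4.4 p.319 (PDF p.93)] -/
theorem exists_thm44Hyp_thetaFrobenioidRebase_and_pins
    (h : E.FrobenioidHyp (𝟙 A) (treeCatVocab (Dα (𝟙 A)) IsRational IsStrictlyRational))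
    (hZ : TW.Λ = MonoidType.Z) (IG : Dα (𝟙 A) → Prop) (gS : ∀ Y : Dα (𝟙 A), IG Y → (X.Pi →* Aut Y))
    (gSs : ∀ (Y : Dα (𝟙 A)) (hY : IG Y), Function.Surjective (gS Y hY))
    (NH : Subgroup (Field.absoluteGaloisGroup K) → (E.thetaFrobenioidRebase A h).category → ℕ+ → Prop)
    (A₀ : (E.thetaFrobenioidRebase A h).category)
    (hA₀ : PreFrobenioid.IsFrobeniusTrivial (E.thetaFrobenioidRebase A h).toElem A₀) (hA₀' : IG A₀.base)
    (h34 : FrdI.Thm34ii.{w, v, max v w, max u v, max (max u v) w})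
    (hBmon : IsMonoidOn (E.thetaFrobenioidRebase A h).ratFnFunctor) (hW : IsSlim DW) (hWf : IsOfFSMType DW)
    (hopen : IsOpen ((BiKummerSetting.mkOfModelCanonical X (E.thetaFrobenioidRebase A h) hZ (E.isPerfect_Φα (𝟙 A)) IG gS
      gSs NH A₀ hA₀ hA₀').Hodot : Set X.Pi))
    (hchar : ∀ Θ : Dα (𝟙 A) ≌ Dα (𝟙 A), IsIsomorph (Θ.functor.obj A₀.base) A₀.base)
    (Ψ : (E.thetaFrobenioidRebase A h).category ≌ (E.thetaFrobenioidRebase A h).category) :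
    ∃ hh : BiKummerSetting.Thm44Hyp
      (BiKummerSetting.mkOfModelCanonical X (E.thetaFrobenioidRebase A h) hZ (E.isPerfect_Φα (𝟙 A)) IG gS gSs NH A₀ hA₀ hA₀')
      (BiKummerSetting.mkOfModelCanonical X (E.thetaFrobenioidRebase A h) hZ (E.isPerfect_Φα (𝟙 A)) IG gS gSs NH A₀ hA₀ hA₀'),
      hh.Ψ = Ψ ∧
        ∃ Ψbs : Dα (𝟙 A) ≌ Dα (𝟙 A), Nonempty
          ((BiKummerSetting.mkOfModelCanonical X (E.thetaFrobenioidRebase A h) hZ (E.isPerfect_Φα (𝟙 A)) IG gS gSs NH A₀ hA₀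
              hA₀').base ⋙ Ψbs.functor ≅
            hh.Ψ.functor ⋙ (BiKummerSetting.mkOfModelCanonical X (E.thetaFrobenioidRebase A h) hZ (E.isPerfect_Φα (𝟙 A)) IG gS gSs
              NH A₀ hA₀ hA₀').base) := by
  obtain ⟨hh, hΨ⟩ := E.exists_thm44Hyp_thetaFrobenioidRebase X A h hZ IG gS gSs NH A₀ hA₀ hA₀' h34 hBmon hW hWf hopen hchar Ψ
  exact ⟨hh, hΨ, (BiKummerSetting.hypothesesThm44_of_thm44Hyp _ hh).2⟩

end Setting

end Example39Data

end Literature.AnabelianGeometry.EtaleTheta
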